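import Summits.NavierStokesRegularity.NavierStokesRegularity.Theses.StretchingWellBinding
import Summits.NavierStokesRegularity.NavierStokesRegularity.Theses.TypeILiouville
import Literature.Analysis.FluidPDE.NSUnconditionalUniquenessHolds
import Literature.Analysis.FluidPDE.NSSerrinRegularityProofs
import Literature.Analysis.FluidPDE.TaoEnstrophyLocalisation
import Summits.NavierStokesRegularity.NavierStokesRegularity.Theorems.StretchingWellBindingEnstrophyQuarterLawCellIntegral
import HarnessLib.Audit

/-!
# Birth skeleton (BC3) of the crux `EnstrophyQuarterLaw`
# (route StretchingWellBinding, crux #2, rank 2; item `stmt-NavierStokesRegularity-1574`)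

Tree path `Cruxes/EnstrophyQuarterLaw/Lines/birth.lean`; registrar
`planner-skel-stmt-NavierStokesRegularity-1574-0`, 2026-08-17 (the route predates the Lean birth
certificate; this file supplies BC3 retroactively). `ledger crux ls stmt-NavierStokesRegularity-1574`:
no workfiles at registration — no `Disproof.lean`, no `_false_without_` theorem, no landed
`Theorems/EnstrophyQuarterLaw/Negative/*` (Disproof used: none available for THIS crux; the sibling
crux's `Cruxes/TypeIliouvilleNoTypeII/Disproof.lean` is honoured by stub 1, see below).

THE CRUX (Q). For `ν > 0` and a classical solution `(u, p)` of unforced Navier–Stokes on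
`ℝ³ × [0, T)` which is MAXIMAL at `T < ∞` (no classical extension past `T`), Leray–Hopf from its
datum `u 0`, and whose datum decays rapidly (Schwartz): the enstrophy obeys Leray's rate from above,
`Ω(t) = ∫ |curl u(t)|² ≤ K (T − t)^{-1/2}` on `[0, T)` (lintegral form) — "no Type II in enstrophy".

THE CUT — "Leray's rate is the spatial integral of the self-similar vorticity envelope over finitely
many Type-I cells". The quarter law factors through the sup-norm Type-I statement of the sibling
route TypeILiouville (its crux `TypeIliouvilleNoTypeII`, item stmt-0056, shared by 14 routes and
staffed by the crux chain) and a QUANTISATION statement that is this route's own content: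

* `stub_noTypeII` [XL; = `Theses.TypeILiouville.TypeIliouvilleNoTypeII` BY NAME]. Every such maximal
  solution is Type I in sup norm: `‖u(t, x)‖ ≤ C (T − t)^{-1/2}` eventually as `t ↑ T`
  (`IsTypeIBlowup u T`). Same binders as Q. Not a new obligation: it is the live shared crux
  stmt-NavierStokesRegularity-0056 (Disproof.lean there: `_false_without_lerayHopf` — the parasitic
  drift `u = g(t)e₁` — is irrelevant to Q itself, whose conclusion holds trivially for curl-free
  flows, but any proof of THIS stub must use the energy class; rate tightness `α = 1/2`). Why Q needs
  it: Q implies it (enstrophy `K(T−t)^{-1/2}` = `H¹` datum of size `K^{1/2}(T−t)^{-1/4}` at every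
  `t`, and the `H¹` local theory with parabolic smoothing gives `‖u‖_∞ ≲ (K/ν)(T − t)^{-1/2}` a fixed
  fraction of the lifespan later; Leray 1934 §19, RobinsonRodrigoSadowski2016 Thm 6.8/Lemma 6.11,
  Tao2011 Thm 5.4), so no proof of Q can avoid proving sup-norm Type I for the solution at hand.
* `stub_typeICells` [XL; THE HEART — quantisation of a Type-I blow-up into finitely many cells].
  Under the binders of Q AND the Type-I rate `IsTypeIBlowup u T`: there are a time `t₀ ∈ [0, T)`,
  finitely many centres `c₁ … c_N ∈ ℝ³`, a radius `ρ > 0` and constants `A, B ≥ 0` such that for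
  every `t ∈ [t₀, T)` (i) inside each ball `B(c_i, ρ)` the vorticity sits under the SELF-SIMILAR
  ENVELOPE `|curl u(t, x)|² ≤ A / ((T − t) + |x − c_i|²)²` (the space-time Type-I profile
  `|ω| ≲ (√(T−t) + r)^{-2}`, i.e. `|∇U(y)| ≲ (1 + |y|)^{-2}` in similarity variables), and (ii) off
  the cells the enstrophy stays bounded up to `T`: `∫_{ℝ³ ∖ ⋃ B(c_i, ρ)} |curl u(t)|² ≤ B`. In words:
  a Type-I blow-up of a finite-energy solution has finitely many singular points at time `T`, around
  each of which the vorticity is bounded by the self-similar envelope, and is regular (with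
  uniformly bounded enstrophy, far field included) elsewhere. WHY EASIER THAN Q (transfer, not
  costume): every hypothesis a Type-I tool needs is now in hand — bounded rescalings, blow-up limits
  that are bounded ancient (mild) solutions (KNSS2009 / in tree `KNSS2009_blowup_generates_ancient`),
  ε-regularity at every scale (CKN1982, Lin1998; in tree), persistence of singularities and local
  concentration at the Type-I scale (Barker–Prange arXiv:1812.09115; AlbrittonBarker2019
  arXiv:1811.00502, in tree `LocalTypeI*`), finiteness of the singular set under critical bounds
  (Choe–Wolf–Yang 2018 `L^∞_t L^{3,∞}_x`, Wang–Zhang 2014; Seregin's Type-I programme), far-field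
  enstrophy localisation (Tao2011 Thm 10.1 / Cor 11.1, in tree `tao2011_boundedEnstrophy_holds`,
  `tao2011_enstrophyLocalisation*`). What remains open is exactly the counting: finitely many cells
  carrying the `(1 + |y|)^{-2}` envelope. Why it might fail: (a) sup-norm Type I + finite energy is
  not known to make the singular set at time `T` finite (only `𝒫¹`-null, CKN); (b) a bounded ancient
  Type-I profile need not decay in space, so between two cells the envelope's `|y|^{-2}` tail is a
  genuine bet (finite energy + energy equality forbid non-decay on the energy scale `(T−t)^{1/3}`,
  not on the self-similar scale); (c) the off-cell bound needs regularity up to `T` away from the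
  cells plus the far field, which is Tao's localisation once (a) holds. A failure of (a)/(b) with Q
  true would be a Type-I blow-up with infinitely many ever-weaker cells — excluded by Q itself
  (under Q every scaled energy `r⁻¹∫∫_{Q_r(x,T)}|∇u|²` is `≤ 2K`, and one-scale ε-regularity under bounded scaled
  quantities forces `≥ ε(M)` at all small scales around a singular point, so disjoint cylinders give `N ≤ 2K/ε(M)`),
  so the heart is the crux's own picture made pointwise. Sources: Leray1934 §§19–22; CKN1982;
  KNSS2009 arXiv:0709.3599; SereginSverak2009 arXiv:0804.1803; AlbrittonBarker2019 arXiv:1811.00502;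
  BarkerPrange2020 arXiv:1812.09115; ChoeWolfYang2018 (doi:10.1007/s00208-017-1595-3);
  Tao2011 arXiv:1108.1165 §§10–11; Seregin2020 arXiv:2006.04140 (axisymmetric singular points are
  Type II — so under stub 1 axisymmetric flows never reach the heart).
* `stub_cellIntegral` [M; the self-similar envelope integrates to Leray's rate]. There is an
  absolute `c₀ > 0` with `∫_{ℝ³} A/((s + |x − x₀|²)²) dx ≤ c₀ A / √s` for all centres `x₀`, `s > 0`,
  `A ≥ 0` (exact value `π²/√s`: translate, scale `x = √s·y`, `∫_{ℝ³}(1+|y|²)^{-2}dy = π²`; Mathlib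
  `integrable_rpow_neg_one_add_norm_sq` with `r = 4 > 3`, `Measure.addHaar_smul`). Pure measure
  theory, no NS content, but a genuine lemma — it is where the exponent `½` of Q comes from
  (dimension 3 minus envelope degree 4, halved).

COMPOSITION (real, this file): `EnstrophyQuarterLaw_of : Theses.StretchingWellBinding.EnstrophyQuarterLaw`
— the ONLY theorem concluding the crux, BY NAME, no hypotheses; it calls the three stubs by name and
does the remaining work itself: stub 1 gives the Type-I rate; the heart gives `t₀, (c_i), ρ, A, B`;
switch at `t₁ := max t₀ (T/2) ∈ (0, T)`; EARLY slab `[0, t₁]`: enstrophy bounded by `B₀` — PROVED here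
from the tree (Tao 2011 Cor. 11.1 `tao2011_boundedEnstrophy_holds` on the closed slab, fed by the
Leray–Hopf energy inequality `IsLerayHopfOn.eEnergy_le_datum` and the Schwartz datum
`HasRapidSpatialDecay.lintegral_enorm_iteratedFDeriv_sq_lt_top`, then `|curl v| ≤ ‖curlCLM‖ |Dv|`);
LATE times `[t₁, T)`: split `∫ = ∫_{⋃ balls} + ∫_{complement}`, bound the union by the finite sum of
the cell integrals (`lintegral_iUnion_le`, envelope pointwise, `stub_cellIntegral` per cell) and the
complement by `B`; finally `K := N c₀ A + (B + B₀) √T` serves both regimes since `√(T − t) ≤ √T`.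
`lean check`: rc 0; sorries = the 3 stubs, nothing else (audit quoted in `Lines/birth.md`).

WIRING 2026-08-28 (ns-hhe-c1 g5, statements byte-identical): `stub_cellIntegral` is CLOSED BY NAME by the landed
Theorems file `…EnstrophyQuarterLawCellIntegral.lean` (`Theorems.EnstrophyQuarterLaw.Birth.cellIntegral`,
`--supports stmt-NavierStokesRegularity-1574`); `sorry` now remains exactly in `stub_noTypeII` (= stmt-0056, OPEN) and
the heart `stub_typeICells` (OPEN). No summit is proved by this file; `EnstrophyQuarterLaw` (1574) stays OPEN.
-/

noncomputable section

open Set MeasureTheory Filter Topology Metric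
open scoped ENNReal NNReal
open Literature.Analysis.FluidPDE

namespace Summit.NavierStokesRegularity.NavierStokesRegularity.Cruxes.EnstrophyQuarterLaw.Birth

set_option linter.unusedVariables false
set_option linter.dupNamespace false

/-- **stub 1 — `stub_noTypeII` (XL; the sibling crux `TypeIliouvilleNoTypeII`, item
stmt-NavierStokesRegularity-0056, BY NAME).** Every finite-energy classical solution from a rapidly
decaying datum whose classical lifespan `T` is finite is Type I in sup norm:
`∃ C, ∀ᶠ t ↑ T, ∀ x, ‖u t x‖ ≤ C / √(T − t)`. Sources: Leray1934 §20 (matching lower rate,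
`leray_blowup_rate_top_holds`), KNSS2009 arXiv:0709.3599, Seregin2012 arXiv:1104.3615,
Tao2021 arXiv:1908.04958; why it might fail: a Type-II singularity = ¬Clay (A) (Hou2022
arXiv:2107.06509 with KNSS Thm 6.1: axisymmetric singularities are Type II). -/
theorem stub_noTypeII :
    Summit.NavierStokesRegularity.NavierStokesRegularity.Theses.TypeILiouville.TypeIliouvilleNoTypeII := by
  sorry

/-- **stub 2 — `stub_typeICells` (XL; the heart: a Type-I blow-up of a finite-energy solution is
quantised into finitely many self-similar cells).** Under the binders of the crux and the sup-norm
Type-I rate: `∃ t₀ ∈ [0,T)`, finitely many centres `c : Fin N → ℝ³`, `ρ > 0`, `A, B ≥ 0` with, for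
all `t ∈ [t₀, T)`: (i) `‖curl (u t) x‖² ≤ A / ((T − t) + ‖x − c i‖²)²` on each `ball (c i) ρ`;
(ii) `∫⁻_{(⋃ i, ball (c i) ρ)ᶜ} ‖curl (u t)‖ₑ² ≤ B`. Sources: CKN1982, KNSS2009, AlbrittonBarker2019
arXiv:1811.00502, BarkerPrange2020 arXiv:1812.09115, ChoeWolfYang2018, Tao2011 arXiv:1108.1165 §§10–11;
why it might fail: finiteness of the singular set and the `|y|⁻²` spatial tail of Type-I profiles are
open (sup-norm Type I + finite energy give neither). -/
theorem stub_typeICells :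
    ∀ (ν T : ℝ), 0 < ν → 0 < T →
    ∀ (u : ℝ → EuclideanSpace ℝ (Fin 3) → EuclideanSpace ℝ (Fin 3))
      (p : ℝ → EuclideanSpace ℝ (Fin 3) → ℝ),
    Literature.Analysis.FluidPDE.IsMaximalSmoothSolution ν 0 u p T →
    Literature.Analysis.FluidPDE.IsLerayHopfOn T ν 0 (u 0) u →
    Literature.Analysis.FluidPDE.HasRapidSpatialDecay (u 0) →
    Literature.Analysis.FluidPDE.IsTypeIBlowup u T →
    ∃ t₀ ∈ Set.Ico 0 T, ∃ (N : ℕ) (c : Fin N → EuclideanSpace ℝ (Fin 3)) (ρ A B : ℝ),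
      0 < ρ ∧ 0 ≤ A ∧ 0 ≤ B ∧
      ∀ t ∈ Set.Ico t₀ T,
        (∀ i : Fin N, ∀ x ∈ Metric.ball (c i) ρ,
          ‖Literature.Analysis.FluidPDE.curl (u t) x‖ ^ 2 ≤ A / ((T - t) + ‖x - c i‖ ^ 2) ^ 2) ∧
        ∫⁻ x in (⋃ i : Fin N, Metric.ball (c i) ρ)ᶜ,
            ‖Literature.Analysis.FluidPDE.curl (u t) x‖ₑ ^ 2 ≤ ENNReal.ofReal B := by
  sorry

/-- **stub 3 — `stub_cellIntegral` (M; the self-similar envelope integrates to Leray's rate).**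
`∃ c₀ > 0, ∀ x₀ s A, 0 < s → 0 ≤ A → ∫⁻ x, ofReal (A / ((s + ‖x − x₀‖²)²)) ≤ ofReal (c₀ A / √s)`
on `ℝ³` (exact constant `π²`). Sources: folklore (translation + scaling of Haar measure, Mathlib
`integrable_rpow_neg_one_add_norm_sq`, `Measure.addHaar_smul`). -/
theorem stub_cellIntegral :
    ∃ c₀ : ℝ, 0 < c₀ ∧ ∀ (x₀ : EuclideanSpace ℝ (Fin 3)) (s A : ℝ), 0 < s → 0 ≤ A →
      ∫⁻ x, ENNReal.ofReal (A / ((s + ‖x - x₀‖ ^ 2) ^ 2)) ≤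
        ENNReal.ofReal (c₀ * A / Real.sqrt s) :=
  -- CLOSED 2026-08-28 (ns-hhe-c1 g5): the landed measure-theory lemma (signature verbatim).
  Summit.NavierStokesRegularity.NavierStokesRegularity.Theorems.EnstrophyQuarterLaw.Birth.cellIntegral

/-! ### Proved glue (no placeholder below this line) -/

/-- **Early-slab enstrophy bound** (PROVED; Tao 2011 Cor. 11.1 in the crux's classes). A classical
solution on `[0, T)` which is Leray–Hopf from a rapidly decaying datum has bounded enstrophy
`∫ |curl u(t)|² ≤ B₀` on every closed sub-slab `[0, t₁]`, `0 < t₁ < T`: the Leray–Hopf energy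
inequality (`IsLerayHopfOn.eEnergy_le_datum`) and the Schwartz datum
(`HasRapidSpatialDecay.lintegral_enorm_iteratedFDeriv_sq_lt_top`) feed the tree theorem
`tao2011_boundedEnstrophy_holds` (`u ∈ X¹([0, t₁] × ℝ³)`), and `|curl v| ≤ ‖curlCLM‖ |Dv|`. -/
theorem earlySlab_enstrophy_bound {ν T : ℝ} (hν : 0 < ν)
    {u : ℝ → EuclideanSpace ℝ (Fin 3) → EuclideanSpace ℝ (Fin 3)}
    {p : ℝ → EuclideanSpace ℝ (Fin 3) → ℝ}
    (hcl : IsClassicalNSSolutionOn (Ico 0 T) ν 0 u p) (hLH : IsLerayHopfOn T ν 0 (u 0) u)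
    (hdec : HasRapidSpatialDecay (u 0)) {t₁ : ℝ} (ht₁ : 0 < t₁) (ht₁T : t₁ < T) :
    ∃ B₀ : ℝ, 0 ≤ B₀ ∧ ∀ t ∈ Icc 0 t₁, ∫⁻ x, ‖curl (u t) x‖ₑ ^ 2 ≤ ENNReal.ofReal B₀ := by
  have hcl₁ : IsClassicalNSSolutionOn (Icc 0 t₁) ν 0 u p :=
    hcl.mono (Icc_subset_Ico_right ht₁T) (uniqueDiffOn_Icc ht₁)
  have hE : ∃ C : ℝ≥0, ∀ t ∈ Icc 0 t₁, ∫⁻ x, ‖u t x‖ₑ ^ 2 ≤ C := by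
    refine ⟨(2 * VectorCalculus.kineticEnergy (u 0)).toNNReal, fun t ht => ?_⟩
    exact hLH.eEnergy_le_datum hν.le ⟨ht.1, ht.2.trans ht₁T.le⟩
  have hX : MemSobolevX 1 t₁ u :=
    tao2011_boundedEnstrophy_holds hν ht₁ hcl₁ hE (hdec.lintegral_enorm_iteratedFDeriv_sq_lt_top 1)
  obtain ⟨C₁, hC₁⟩ := hX.1 1 le_rfl
  -- the constant `κ = ‖curlCLM‖` of `|curl v| ≤ κ |Dv|`
  obtain ⟨κ, hκ0, hκ⟩ : ∃ κ : ℝ, 0 ≤ κ ∧ ∀ (v : EuclideanSpace ℝ (Fin 3) → EuclideanSpace ℝ (Fin 3))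
      (x : EuclideanSpace ℝ (Fin 3)), ‖curl v x‖ ≤ κ * ‖fderiv ℝ v x‖ := by
    refine ⟨_, ?_, norm_curl_le⟩
    exact ContinuousLinearMap.opNorm_nonneg _
  have hfin : ENNReal.ofReal (κ ^ 2) * (C₁ : ℝ≥0∞) ≠ ⊤ :=
    ENNReal.mul_ne_top ENNReal.ofReal_ne_top ENNReal.coe_ne_top
  refine ⟨(ENNReal.ofReal (κ ^ 2) * (C₁ : ℝ≥0∞)).toReal, ENNReal.toReal_nonneg, fun t ht => ?_⟩
  rw [ENNReal.ofReal_toReal hfin]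
  calc ∫⁻ x, ‖curl (u t) x‖ₑ ^ 2
      ≤ ∫⁻ x, ENNReal.ofReal (κ ^ 2) * ‖iteratedFDeriv ℝ 1 (u t) x‖ₑ ^ 2 := by
        refine lintegral_mono fun x => ?_
        have h2 : ‖curl (u t) x‖ₑ ≤ ENNReal.ofReal κ * ‖fderiv ℝ (u t) x‖ₑ := by
          rw [← ofReal_norm, ← ofReal_norm, ← ENNReal.ofReal_mul hκ0]
          exact ENNReal.ofReal_le_ofReal (hκ (u t) x)
        calc ‖curl (u t) x‖ₑ ^ 2 ≤ (ENNReal.ofReal κ * ‖fderiv ℝ (u t) x‖ₑ) ^ 2 :=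
              pow_le_pow_left' h2 2
          _ = ENNReal.ofReal (κ ^ 2) * ‖iteratedFDeriv ℝ 1 (u t) x‖ₑ ^ 2 := by
              rw [mul_pow, ENNReal.ofReal_pow hκ0, enorm_iteratedFDeriv_one]
    _ = ENNReal.ofReal (κ ^ 2) * ∫⁻ x, ‖iteratedFDeriv ℝ 1 (u t) x‖ₑ ^ 2 :=
        lintegral_const_mul' _ _ ENNReal.ofReal_ne_top
    _ ≤ ENNReal.ofReal (κ ^ 2) * (C₁ : ℝ≥0∞) := mul_le_mul_right (hC₁ t ht) _

/-! ### The composition (real proof) -/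

/-- **The skeleton theorem = the composition** (concludes the crux
`Theses.StretchingWellBinding.EnstrophyQuarterLaw` BY NAME, no hypotheses; placeholders only inside
the three declared stubs, all three used by name). Sup-norm Type I (stub 1) × quantisation into
finitely many self-similar cells (heart) × the cell integral `∫ A/((T−t)+r²)² = O(A/√(T−t))`
(stub 3), glued with the PROVED early-slab bound and `√(T − t) ≤ √T`:
`K := N c₀ A + (B + B₀) √T`. -/
theorem EnstrophyQuarterLaw_of : Theses.StretchingWellBinding.EnstrophyQuarterLaw := by
  intro ν T hν hT u p hmax hLH hdec
  -- stub 1: the sup-norm Type-I rate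
  have hTI : IsTypeIBlowup u T := stub_noTypeII ν T hν hT u p hmax hLH hdec
  -- the heart: finitely many self-similar cells from some `t₀` on
  obtain ⟨t₀, ht₀, N, c, ρ, A, B, hρ, hA, hB, hcell⟩ :=
    stub_typeICells ν T hν hT u p hmax hLH hdec hTI
  -- stub 3: the cell integral
  obtain ⟨c₀, hc₀, hint⟩ := stub_cellIntegral
  -- switching time `t₁ := max t₀ (T/2) ∈ (0, T)`
  set t₁ : ℝ := max t₀ (T / 2) with ht₁def
  have ht₁pos : 0 < t₁ := lt_max_of_lt_right (by positivity)
  have ht₁T : t₁ < T := max_lt ht₀.2 (by linarith)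
  have ht₀t₁ : t₀ ≤ t₁ := le_max_left _ _
  -- early slab `[0, t₁]`: PROVED bound `B₀`
  obtain ⟨B₀, hB₀, hearly⟩ := earlySlab_enstrophy_bound hν hmax.1 hLH hdec ht₁pos ht₁T
  refine ⟨(N : ℝ) * c₀ * A + (B + B₀) * Real.sqrt T, fun t ht => ?_⟩
  have hTt : 0 < T - t := sub_pos.2 ht.2
  have hsq : 0 < Real.sqrt (T - t) := Real.sqrt_pos.2 hTt
  have hsqle : Real.sqrt (T - t) ≤ Real.sqrt T := Real.sqrt_le_sqrt (by linarith [ht.1])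
  have hNcA : 0 ≤ (N : ℝ) * c₀ * A := by positivity
  have hBs : B * Real.sqrt (T - t) ≤ B * Real.sqrt T := mul_le_mul_of_nonneg_left hsqle hB
  have hB₀s : B₀ * Real.sqrt (T - t) ≤ B₀ * Real.sqrt T := mul_le_mul_of_nonneg_left hsqle hB₀
  rcases lt_or_ge t t₁ with hlt | hge
  · -- EARLY times `t < t₁`
    calc ∫⁻ x, ‖curl (u t) x‖ₑ ^ 2 ≤ ENNReal.ofReal B₀ := hearly t ⟨ht.1, hlt.le⟩
      _ ≤ ENNReal.ofReal (((N : ℝ) * c₀ * A + (B + B₀) * Real.sqrt T) / Real.sqrt (T - t)) := by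
          refine ENNReal.ofReal_le_ofReal ?_
          rw [le_div_iff₀ hsq]
          nlinarith [mul_nonneg hB (Real.sqrt_nonneg T)]
  · -- LATE times `t₁ ≤ t < T`, inside the heart's window `[t₀, T)`
    obtain ⟨henv, hoff⟩ := hcell t ⟨ht₀t₁.trans hge, ht.2⟩
    have hUm : MeasurableSet (⋃ i : Fin N, Metric.ball (c i) ρ) :=
      (isOpen_iUnion fun i => Metric.isOpen_ball).measurableSet
    -- one cell: envelope pointwise, then the cell integral
    have hball : ∀ i : Fin N,
        ∫⁻ x in Metric.ball (c i) ρ, ‖curl (u t) x‖ₑ ^ 2 ≤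
          ENNReal.ofReal (c₀ * A / Real.sqrt (T - t)) := by
      intro i
      calc ∫⁻ x in Metric.ball (c i) ρ, ‖curl (u t) x‖ₑ ^ 2
          ≤ ∫⁻ x in Metric.ball (c i) ρ, ENNReal.ofReal (A / ((T - t) + ‖x - c i‖ ^ 2) ^ 2) := by
            refine setLIntegral_mono' measurableSet_ball fun x hx => ?_
            rw [← ofReal_norm, ← ENNReal.ofReal_pow (norm_nonneg _)]
            exact ENNReal.ofReal_le_ofReal (henv i x hx)
        _ ≤ ∫⁻ x, ENNReal.ofReal (A / ((T - t) + ‖x - c i‖ ^ 2) ^ 2) :=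
            setLIntegral_le_lintegral _ _
        _ ≤ ENNReal.ofReal (c₀ * A / Real.sqrt (T - t)) := hint (c i) (T - t) A hTt hA
    -- the union of the cells: finitely many cell integrals
    have hUle : ∫⁻ x in ⋃ i : Fin N, Metric.ball (c i) ρ, ‖curl (u t) x‖ₑ ^ 2 ≤
        (N : ℝ≥0∞) * ENNReal.ofReal (c₀ * A / Real.sqrt (T - t)) := by
      calc ∫⁻ x in ⋃ i : Fin N, Metric.ball (c i) ρ, ‖curl (u t) x‖ₑ ^ 2
          ≤ ∑' i : Fin N, ∫⁻ x in Metric.ball (c i) ρ, ‖curl (u t) x‖ₑ ^ 2 :=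
            lintegral_iUnion_le _ _
        _ = ∑ i : Fin N, ∫⁻ x in Metric.ball (c i) ρ, ‖curl (u t) x‖ₑ ^ 2 := tsum_fintype _
        _ ≤ ∑ _i : Fin N, ENNReal.ofReal (c₀ * A / Real.sqrt (T - t)) :=
            Finset.sum_le_sum fun i _ => hball i
        _ = (N : ℝ≥0∞) * ENNReal.ofReal (c₀ * A / Real.sqrt (T - t)) := by
            rw [Finset.sum_const, Finset.card_univ, Fintype.card_fin, nsmul_eq_mul]
    have hpos : 0 ≤ (N : ℝ) * (c₀ * A / Real.sqrt (T - t)) := by positivity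
    calc ∫⁻ x, ‖curl (u t) x‖ₑ ^ 2
        = (∫⁻ x in ⋃ i : Fin N, Metric.ball (c i) ρ, ‖curl (u t) x‖ₑ ^ 2) +
            ∫⁻ x in (⋃ i : Fin N, Metric.ball (c i) ρ)ᶜ, ‖curl (u t) x‖ₑ ^ 2 :=
          (lintegral_add_compl (μ := volume) (fun x => ‖curl (u t) x‖ₑ ^ 2) hUm).symm
      _ ≤ (N : ℝ≥0∞) * ENNReal.ofReal (c₀ * A / Real.sqrt (T - t)) + ENNReal.ofReal B :=
          add_le_add hUle hoff
      _ = ENNReal.ofReal ((N : ℝ) * (c₀ * A / Real.sqrt (T - t)) + B) := by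
          rw [ENNReal.ofReal_add hpos hB, ENNReal.ofReal_mul (Nat.cast_nonneg N),
            ENNReal.ofReal_natCast]
      _ ≤ ENNReal.ofReal (((N : ℝ) * c₀ * A + (B + B₀) * Real.sqrt T) / Real.sqrt (T - t)) := by
          refine ENNReal.ofReal_le_ofReal ?_
          rw [le_div_iff₀ hsq]
          have hs0 : Real.sqrt (T - t) ≠ 0 := hsq.ne'
          calc ((N : ℝ) * (c₀ * A / Real.sqrt (T - t)) + B) * Real.sqrt (T - t)
              = (N : ℝ) * c₀ * A + B * Real.sqrt (T - t) := by
                rw [add_mul, mul_assoc, div_mul_cancel₀ _ hs0]; ring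
            _ ≤ (N : ℝ) * c₀ * A + (B + B₀) * Real.sqrt T := by
                nlinarith [mul_nonneg hB₀ (Real.sqrt_nonneg T)]

end Summit.NavierStokesRegularity.NavierStokesRegularity.Cruxes.EnstrophyQuarterLaw.Birth
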